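import Literature.Algebra.EuclideanLattices.GramSchmidtTableBounds
import HarnessLib

/-!
# Cohen's integer Gram–Schmidt table as a list program

Topic `Algebra/EuclideanLattices`, sequel of `LLLIntegral.lean` (`uRec`, `dRec`) and
`GramSchmidtTableBounds.lean`. The reduction machine of the discharge of Aaronson–Arkhipov's
Thm. 1.3 (`Literature.Computability.QuantumComplexity.gpeSolvableInFBPPRel_NPRel_of_approxBosonSamplingOracle`)
runs Cohen's recursion on LISTS (rows of integers, tables as lists of rows), level by level, as a
left fold; this file is that list program and its agreement with `uRec`/`dRec`:

* `dotZ`, `tabEntry`, `gramTable rows C` (level `0`: `⟪rowᵢ, rowⱼ⟫` for all rows `i` and the first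
  `C` columns), `stepTable l d T` (level `l ↦ l + 1`:
  `T'(i,j) = (T(l,l) T(i,j) - T(j,l) T(i,l)) / d`), `dtRec`/`tableRec`/`dList` (the tables and `d`'s by
  recursion on the level), `levelStep`/`levelsOf` (the same as a left fold over a unary budget,
  `levelsOf_eq`);
* shape: every table has one row per input row, of length `min C |rows|` (`length_tableRec`,
  `length_of_mem_tableRec`);
* **agreement** (`tabEntry_tableRec_eq_uRec`, `dList_eq_dRec`): for ANY list of integer rows, with
  `b` the zero-padded `Fin`-indexed family (`padFamily`), `tableRec l` has entries `uRec b l i j`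
  (`i < |rows|`, `j < min C |rows|`) for all levels `l ≤ min C |rows|`, and `dList l = dRec b l` —
  so the universal size bound `abs_uRec_le_pow` applies to everything the program stores, on every
  input (`abs_tabEntry_tableRec_le`).

All proved.

## References

* H. Cohen, *A Course in Computational Algebraic Number Theory*, GTM 138, Springer 1993,
  Algorithm 2.6.7 (integral Gram–Schmidt, Step 2).
-/

namespace Literature.Algebra.EuclideanLattices

open Finset

/-! ### The list program -/

/-- Integer dot product of two rows (truncating to the shorter). [folklore] -/
def dotZ (u v : List ℤ) : ℤ := (List.zipWith (· * ·) u v).sum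

/-- Entry `(i, j)` of a table (`0` outside). [folklore] -/
def tabEntry (T : List (List ℤ)) (i j : ℕ) : ℤ := (T.getD i []).getD j 0

/-- **Level `0`**: the Gram entries `⟪rowᵢ, rowⱼ⟫` for all rows `i` and columns `j < C`.
[cite: Cohen1993, Algorithm 2.6.7 (Step 1)] -/
def gramTable (rows : List (List ℤ)) (C : ℕ) : List (List ℤ) :=
  rows.map fun ri => (rows.take C).map fun rj => dotZ ri rj

/-- **One level of Cohen's recursion on a table**:
`T'(i,j) = (T(l,l) · T(i,j) - T(j,l) · T(i,l)) / d` (integer division). [cite: Cohen1993, Algorithm 2.6.7 (Step 2)] -/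
def stepTable (l : ℕ) (d : ℤ) (T : List (List ℤ)) : List (List ℤ) :=
  T.map fun row => ((List.range row.length).zip row).map fun q =>
    (tabEntry T l l * q.2 - (T.map fun r => r.getD l 0).getD q.1 0 * row.getD l 0) / d

/-- The pairs `(d_l, T_l)` by recursion on the level: `d₀ = 1`, `T₀` the Gram table,
`d_{l+1} = T_l(l,l)`, `T_{l+1} = stepTable l d_l T_l`. [folklore] -/
def dtRec (rows : List (List ℤ)) (C : ℕ) : ℕ → ℤ × List (List ℤ)
  | 0 => (1, gramTable rows C)
  | l + 1 => (tabEntry (dtRec rows C l).2 l l, stepTable l (dtRec rows C l).1 (dtRec rows C l).2)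

/-- The table at level `l`. [folklore] -/
def tableRec (rows : List (List ℤ)) (C l : ℕ) : List (List ℤ) := (dtRec rows C l).2

/-- The `d` at level `l`: `d₀ = 1`, `d_{l+1} = T_l(l,l)`. [folklore] -/
def dList (rows : List (List ℤ)) (C l : ℕ) : ℤ := (dtRec rows C l).1

/-- Unfolding `tableRec` at `0`. [folklore] -/
theorem tableRec_zero (rows : List (List ℤ)) (C : ℕ) : tableRec rows C 0 = gramTable rows C := rfl

/-- Unfolding `dList` at `0`. [folklore] -/
theorem dList_zero (rows : List (List ℤ)) (C : ℕ) : dList rows C 0 = 1 := rfl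

/-- Unfolding `dList` at a successor. [folklore] -/
theorem dList_succ (rows : List (List ℤ)) (C l : ℕ) : dList rows C (l + 1) = tabEntry (tableRec rows C l) l l := rfl

/-- Unfolding `tableRec` at a successor. [folklore] -/
theorem tableRec_succ (rows : List (List ℤ)) (C l : ℕ) :
    tableRec rows C (l + 1) = stepTable l (dList rows C l) (tableRec rows C l) := rfl

/-- The state of the level fold: `(l, d_l, T_l, [(d₀, T₀), …, (d_{l-1}, T_{l-1})])`. One step.
[folklore] -/
def levelStep (st : ℕ × ℤ × List (List ℤ) × List (ℤ × List (List ℤ))) (_ : Unit) :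
    ℕ × ℤ × List (List ℤ) × List (ℤ × List (List ℤ)) :=
  (st.1 + 1, tabEntry st.2.2.1 st.1 st.1, stepTable st.1 st.2.1 st.2.2.1, st.2.2.2 ++ [(st.2.1, st.2.2.1)])

/-- **The levels as a left fold over a unary budget**: the list `[(d₀, T₀), …, (d_{K-1}, T_{K-1})]`.
[folklore] -/
def levelsOf (rows : List (List ℤ)) (C K : ℕ) : List (ℤ × List (List ℤ)) :=
  ((List.replicate K ()).foldl levelStep (0, 1, gramTable rows C, [])).2.2.2

/-- The fold state after `K` steps. [folklore] -/
theorem foldl_levelStep (rows : List (List ℤ)) (C : ℕ) : ∀ (K : ℕ) (acc : List (ℤ × List (List ℤ))) (l₀ : ℕ),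
    (List.replicate K ()).foldl levelStep (l₀, dList rows C l₀, tableRec rows C l₀, acc) =
      (l₀ + K, dList rows C (l₀ + K), tableRec rows C (l₀ + K),
        acc ++ (List.range K).map fun t => (dList rows C (l₀ + t), tableRec rows C (l₀ + t)))
  | 0, acc, l₀ => by simp
  | K + 1, acc, l₀ => by
    rw [List.replicate_succ, List.foldl_cons]
    have hstep : levelStep (l₀, dList rows C l₀, tableRec rows C l₀, acc) () =
        (l₀ + 1, dList rows C (l₀ + 1), tableRec rows C (l₀ + 1), acc ++ [(dList rows C l₀, tableRec rows C l₀)]) := rfl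
    rw [hstep, foldl_levelStep rows C K _ (l₀ + 1), List.range_succ_eq_map, List.map_cons, List.map_map,
      List.append_assoc, List.singleton_append, show l₀ + 1 + K = l₀ + (K + 1) by omega]
    simp only [Nat.add_zero, Function.comp_def, Nat.succ_eq_add_one,
      show ∀ t, l₀ + 1 + t = l₀ + (t + 1) from fun t => by omega]

/-- **The level fold computes the tables.** [folklore] -/
theorem levelsOf_eq (rows : List (List ℤ)) (C K : ℕ) :
    levelsOf rows C K = (List.range K).map fun t => (dList rows C t, tableRec rows C t) := by
  have h := foldl_levelStep rows C K [] 0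
  simp only [Nat.zero_add, List.nil_append] at h
  unfold levelsOf
  exact (congrArg (fun st => st.2.2.2) h)

/-! ### Shape -/

/-- Every row of the Gram table has length `min C |rows|`, and there is one per input row. [folklore] -/
theorem length_gramTable (rows : List (List ℤ)) (C : ℕ) : (gramTable rows C).length = rows.length := by
  simp [gramTable]

/-- Rows of the Gram table have length `min C |rows|`. [folklore] -/
theorem length_of_mem_gramTable (rows : List (List ℤ)) (C : ℕ) {row : List ℤ} (h : row ∈ gramTable rows C) :
    row.length = min C rows.length := by
  simp only [gramTable, List.mem_map] at h
  obtain ⟨ri, _, rfl⟩ := h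
  simp [List.length_take]

/-- `stepTable` keeps the shape. [folklore] -/
theorem length_stepTable (l : ℕ) (d : ℤ) (T : List (List ℤ)) : (stepTable l d T).length = T.length := by
  simp [stepTable]

/-- Rows of `stepTable` have the lengths of the rows of the table. [folklore] -/
theorem length_of_mem_stepTable (l : ℕ) (d : ℤ) (T : List (List ℤ)) {row : List ℤ}
    (h : row ∈ stepTable l d T) : ∃ row₀ ∈ T, row.length = row₀.length := by
  simp only [stepTable, List.mem_map] at h
  obtain ⟨row₀, h0, rfl⟩ := h
  exact ⟨row₀, h0, by simp⟩

/-- The tables have one row per input row. [folklore] -/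
theorem length_tableRec (rows : List (List ℤ)) (C : ℕ) : ∀ l, (tableRec rows C l).length = rows.length
  | 0 => by rw [tableRec_zero, length_gramTable]
  | l + 1 => by rw [tableRec_succ, length_stepTable, length_tableRec rows C l]

/-- Every row of every table has length `min C |rows|`. [folklore] -/
theorem length_of_mem_tableRec (rows : List (List ℤ)) (C : ℕ) :
    ∀ (l : ℕ) {row : List ℤ}, row ∈ tableRec rows C l → row.length = min C rows.length
  | 0, _, h => length_of_mem_gramTable rows C (by rwa [tableRec_zero] at h)
  | l + 1, row, h => by
    rw [tableRec_succ] at h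
    obtain ⟨row₀, h0, hlen⟩ := length_of_mem_stepTable _ _ _ h
    rw [hlen, length_of_mem_tableRec rows C l h0]

/-! ### Entries -/

/-- An entry inside the table. [folklore] -/
theorem tabEntry_eq_getElem (T : List (List ℤ)) {i j : ℕ} (hi : i < T.length) (hj : j < (T[i]).length) :
    tabEntry T i j = T[i][j] := by
  unfold tabEntry
  rw [List.getD_eq_getElem T [] hi, List.getD_eq_getElem T[i] 0 hj]

/-- An entry past the rows is `0`. [folklore] -/
theorem tabEntry_eq_zero_of_row (T : List (List ℤ)) {i j : ℕ} (hi : T.length ≤ i) : tabEntry T i j = 0 := by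
  unfold tabEntry
  rw [List.getD_eq_default T [] hi, List.getD_nil]

/-- An entry past the end of its row is `0`. [folklore] -/
theorem tabEntry_eq_zero_of_col (T : List (List ℤ)) {i j : ℕ} (hi : i < T.length) (hj : (T[i]).length ≤ j) :
    tabEntry T i j = 0 := by
  unfold tabEntry
  rw [List.getD_eq_getElem T [] hi, List.getD_eq_default T[i] 0 hj]

/-- Entries of the Gram table. [folklore] -/
theorem tabEntry_gramTable (rows : List (List ℤ)) (C : ℕ) {i j : ℕ} (hi : i < rows.length)
    (hj : j < min C rows.length) :
    tabEntry (gramTable rows C) i j = dotZ rows[i] (rows[j]'(lt_of_lt_of_le hj (min_le_right _ _))) := by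
  have hi' : i < (gramTable rows C).length := by rwa [length_gramTable]
  have hj' : j < ((gramTable rows C)[i]).length := by
    rw [length_of_mem_gramTable rows C (List.getElem_mem hi')]; exact hj
  rw [tabEntry_eq_getElem _ hi' hj']
  simp [gramTable, List.getElem_take]

/-- Entries of `stepTable`. [folklore] -/
theorem tabEntry_stepTable (l : ℕ) (d : ℤ) (T : List (List ℤ)) {i j : ℕ} (hi : i < T.length)
    (hj : j < (T[i]).length) :
    tabEntry (stepTable l d T) i j =
      (tabEntry T l l * tabEntry T i j - tabEntry T j l * tabEntry T i l) / d := by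
  have hi' : i < (stepTable l d T).length := by rwa [length_stepTable]
  have hrow : (stepTable l d T)[i] = ((List.range (T[i]).length).zip T[i]).map fun q =>
      (tabEntry T l l * q.2 - (T.map fun r => r.getD l 0).getD q.1 0 * (T[i]).getD l 0) / d := by
    simp [stepTable, List.getElem_map]
  have hj' : j < ((stepTable l d T)[i]).length := by rw [hrow]; simpa using hj
  rw [tabEntry_eq_getElem _ hi' hj']
  simp only [hrow, List.getElem_map, List.getElem_zip, List.getElem_range]
  congr 2
  · rw [tabEntry_eq_getElem T hi hj]
  · congr 1
    · -- `(T.map (·.getD l 0)).getD j 0 = tabEntry T j l`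
      by_cases hjT : j < T.length
      · rw [List.getD_eq_getElem (T.map fun r => r.getD l 0) 0 (by simpa using hjT), List.getElem_map, tabEntry,
          List.getD_eq_getElem T [] hjT]
      · push Not at hjT
        rw [List.getD_eq_default (T.map fun r => r.getD l 0) 0 (by simpa using hjT), tabEntry_eq_zero_of_row T hjT]
    · rw [tabEntry, List.getD_eq_getElem T [] hi]

/-! ### Agreement with `uRec` on the zero-padded family -/

/-- The zero-padded `Fin`-indexed family of a list of rows, of width `D`. [folklore] -/
def padFamily (rows : List (List ℤ)) (D : ℕ) (i : Fin rows.length) (t : Fin D) : ℤ := (rows[i]).getD t 0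

/-- A width covering all rows. [folklore] -/
def maxWidth (rows : List (List ℤ)) : ℕ := (rows.map List.length).foldr max 0

/-- Every row fits in the maximal width. [folklore] -/
theorem length_le_maxWidth {rows : List (List ℤ)} {row : List ℤ} (h : row ∈ rows) : row.length ≤ maxWidth rows := by
  unfold maxWidth
  induction rows with
  | nil => simp at h
  | cons a rows ih =>
    rw [List.map_cons, List.foldr_cons]
    rcases List.mem_cons.1 h with rfl | h
    · exact le_max_left _ _
    · exact (ih h).trans (le_max_right _ _)

/-- **The truncating dot product is the padded sum.** [folklore] -/
theorem dotZ_eq_sum (u v : List ℤ) {D : ℕ} (hu : u.length ≤ D) (hv : v.length ≤ D) :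
    dotZ u v = ∑ t : Fin D, u.getD t 0 * v.getD t 0 := by
  induction u generalizing v D with
  | nil => simp [dotZ]
  | cons a u ih =>
    cases v with
    | nil => simp [dotZ]
    | cons c v =>
      cases D with
      | zero => simp at hu
      | succ D =>
        rw [dotZ, List.zipWith_cons_cons, List.sum_cons, Fin.sum_univ_succ]
        simp only [List.length_cons, Nat.succ_le_succ_iff] at hu hv
        have h := ih v hu hv
        rw [dotZ] at h
        rw [h]
        simp

/-- The Gram table entries are the integer Gram entries of the padded family. [folklore] -/
theorem tabEntry_gramTable_eq_intGram (rows : List (List ℤ)) (C : ℕ) {D : ℕ} (hD : maxWidth rows ≤ D)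
    {i j : ℕ} (hi : i < rows.length) (hj : j < min C rows.length) :
    tabEntry (gramTable rows C) i j =
      intGram (padFamily rows D) ⟨i, hi⟩ ⟨j, lt_of_lt_of_le hj (min_le_right _ _)⟩ := by
  rw [tabEntry_gramTable rows C hi hj, intGram,
    dotZ_eq_sum _ _ ((length_le_maxWidth (List.getElem_mem hi)).trans hD)
      ((length_le_maxWidth (List.getElem_mem _)).trans hD)]
  rfl

/-- **The list program computes Cohen's table**: for all levels `l ≤ min C |rows|`, the entries of
`tableRec l` in the rows `i < |rows|` and columns `j < min C |rows|` are `uRec b l i j` for the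
padded family `b`, and `dList l = dRec b l`. [cite: Cohen1993, Algorithm 2.6.7] -/
theorem tabEntry_tableRec_eq_uRec (rows : List (List ℤ)) (C : ℕ) {D : ℕ} (hD : maxWidth rows ≤ D) :
    ∀ (l : ℕ), l ≤ min C rows.length →
      (∀ {i j : ℕ} (hi : i < rows.length) (hj : j < min C rows.length),
        tabEntry (tableRec rows C l) i j =
          uRec (padFamily rows D) l ⟨i, hi⟩ ⟨j, lt_of_lt_of_le hj (min_le_right _ _)⟩) ∧
      dList rows C l = dRec (padFamily rows D) l
  | 0, _ => ⟨fun hi hj => by rw [uRec_zero, tableRec_zero]; exact tabEntry_gramTable_eq_intGram rows C hD hi hj, rfl⟩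
  | l + 1, hl => by
    obtain ⟨ih, ihd⟩ := tabEntry_tableRec_eq_uRec rows C hD l (Nat.le_of_succ_le hl)
    have hlC : l < min C rows.length := hl
    have hlN : l < rows.length := lt_of_lt_of_le hlC (min_le_right _ _)
    refine ⟨fun {i j} hi hj => ?_, ?_⟩
    · rw [tableRec_succ, tabEntry_stepTable l _ _ (by rw [length_tableRec]; exact hi)
        (by rw [length_of_mem_tableRec rows C l (List.getElem_mem _)]; exact hj),
        ih hlN hlC, ih hi hj, ih (lt_of_lt_of_le hj (min_le_right _ _)) hlC, ih hi hlC, ihd,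
        uRec_succ (padFamily rows D) ⟨l, hlN⟩]
    · rw [dList_succ, dRec, dif_pos hlN]
      exact ih hlN hlC

/-- The `d`'s agree. [folklore] -/
theorem dList_eq_dRec (rows : List (List ℤ)) (C : ℕ) {D : ℕ} (hD : maxWidth rows ≤ D) {l : ℕ}
    (hl : l ≤ min C rows.length) : dList rows C l = dRec (padFamily rows D) l :=
  (tabEntry_tableRec_eq_uRec rows C hD l hl).2

/-! ### Size of the entries, on every input -/

/-- Entries outside the computed range are `0`. [folklore] -/
theorem tabEntry_eq_zero_of_le (rows : List (List ℤ)) (C l : ℕ) {i j : ℕ}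
    (h : rows.length ≤ i ∨ min C rows.length ≤ j) : tabEntry (tableRec rows C l) i j = 0 := by
  rcases h with h | h
  · exact tabEntry_eq_zero_of_row _ (by rw [length_tableRec]; exact h)
  · by_cases hi : i < (tableRec rows C l).length
    · exact tabEntry_eq_zero_of_col _ hi (by rw [length_of_mem_tableRec rows C l (List.getElem_mem hi)]; exact h)
    · exact tabEntry_eq_zero_of_row _ (not_lt.1 hi)

/-- **Every entry of every computed table is small**: with `‖rowₖ‖² ≤ B` for the padded rows,
`|T_l(i,j)| ≤ B^{l+1}` for all `l ≤ min C |rows|` and ALL `i, j` (the universal bound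
`abs_uRec_le_pow` inside the range, `0` outside). [folklore] -/
theorem abs_tabEntry_tableRec_le (rows : List (List ℤ)) (C : ℕ) {D : ℕ} (hD : maxWidth rows ≤ D) {B : ℝ}
    (hB : ∀ k : Fin rows.length, ‖(⇑(intVecToEuclidean D).toAddMonoidHom ∘ padFamily rows D) k‖ ^ 2 ≤ B)
    (hB0 : 0 ≤ B) {l : ℕ} (hl : l ≤ min C rows.length) (i j : ℕ) :
    |(tabEntry (tableRec rows C l) i j : ℝ)| ≤ B ^ (l + 1) := by
  by_cases hi : i < rows.length
  · by_cases hj : j < min C rows.length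
    · rw [(tabEntry_tableRec_eq_uRec rows C hD l hl).1 hi hj]
      exact abs_uRec_le_pow _ hB l _ _
    · rw [tabEntry_eq_zero_of_le rows C l (Or.inr (not_lt.1 hj))]
      simp only [Int.cast_zero, abs_zero]; positivity
  · rw [tabEntry_eq_zero_of_le rows C l (Or.inl (not_lt.1 hi))]
    simp only [Int.cast_zero, abs_zero]; positivity

/-- The `d`'s are small: `|d_l| ≤ B^l` for `l ≤ min C |rows|` (`B ≥ 1`). [folklore] -/
theorem abs_dList_le (rows : List (List ℤ)) (C : ℕ) {D : ℕ} (hD : maxWidth rows ≤ D) {B : ℝ} (hB1 : 1 ≤ B)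
    (hB : ∀ k : Fin rows.length, ‖(⇑(intVecToEuclidean D).toAddMonoidHom ∘ padFamily rows D) k‖ ^ 2 ≤ B)
    {l : ℕ} (hl : l ≤ min C rows.length) : |(dList rows C l : ℝ)| ≤ B ^ l := by
  rw [dList_eq_dRec rows C hD hl]
  exact abs_dRec_le_pow _ hB1 hB l

/-- The squared norm of a padded row is the sum of the squares of the entries. [folklore] -/
theorem norm_padFamily_sq (rows : List (List ℤ)) (D : ℕ) (k : Fin rows.length) :
    ‖(⇑(intVecToEuclidean D).toAddMonoidHom ∘ padFamily rows D) k‖ ^ 2 =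
      ∑ t : Fin D, ((rows[k]).getD t 0 : ℝ) ^ 2 := by
  rw [Function.comp_apply, EuclideanSpace.norm_sq_eq]
  refine Finset.sum_congr rfl fun t _ => ?_
  rw [Real.norm_eq_abs, sq_abs]
  rfl

end Literature.Algebra.EuclideanLattices
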